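import Literature.Algebra.Lie.Sl2Strings
import HarnessLib

/-!
# `sl₂`-triples with Casimir `-1`: the weight-one vector is killed by the lowering operator

General Lie theory (namespace `Literature.Algebra.Lie.Sl2`, continuing `Sl2Strings`: the triple
`(H, E, F)` of endomorphisms, weight spaces `wsp H μ`, the Casimir operator
`casimir H E F = 4 F E + H² + 2 H` and its symmetry `casimir (-H) F E = casimir H E F`).

Motivation and dictionary.  For the `(𝔤𝔩₂(ℝ), O(2))`-module of `K`-finite vectors of an
admissible representation of `GL₂(ℝ)`, take `H` the infinitesimal generator of `SO(2)` normalised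
to have the `K`-types as eigenvalues, `E = R` and `F = L` the raising and lowering operators, and
`ε = diag(1, -1) ∈ O(2)` (Bump, *Automorphic Forms and Representations* (1997), §2.5, held text
`book:bump1997-automorphic-forms-representations`, chunks 195–210).  Then `casimir H E F = -4Δ`
for Bump's Casimir element `Δ` (on the weight-`k` discrete series `Δ = (k/2)(1 - k/2)`,
`casimir = k² - 2k`), so **`casimir = -1` is Bump's `λ = ¼`, the case `k = 1`**: by Thm. 2.5.4
(ii) (chunk 206) and Thm. 2.5.5 (iii) (chunk 210) the irreducible admissible modules with
`λ = ¼` and odd parity are the two *limits of discrete series* `𝒟^±(1)` (`K`-types `Σ^±(1)`,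
i.e. `≥ 1` resp. `≤ -1`), glued by `ε` into the single irreducible `(𝔤, O(2))`-module `𝒟_μ(1)` —
Gelbart's `π(1, sgn)`, the archimedean component of a cuspidal representation *of weight one*
(Gelbart, *Three lectures …* (1997), Remark 2.5.2; `AutomorphicRepData.IsOfWeightOne` in
`Automorphic/StrongArtinGL2WeightOneDictionary`).  The defining feature of `𝒟^+(k)` is
`L f_k = 0` for its lowest weight vector (Bump, proof of Thm. 2.5.3, chunk 205: "by Eq. (5.23),
we have `L f_k = R f_{-k} = 0`"); for `k = 1` this is Gelbart's condition `X·φ₁ = 0` making the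
weight-one form holomorphic (Gelbart 1997, chunk 229 and Remark 2.5.5).

This file proves that feature **abstractly, from the Casimir value alone plus irreducibility**,
in the form needed for automorphic representation *data* (where only the infinitesimal character
— hence the Casimir scalar — and irreducibility under `(𝔤, K∞) × G(𝔸_f)` are available, not a
model of `π_∞`):

* `casimir_apply_of_mem_EF`: `C v = 4 E F v + (μ² - 2μ) v` on `V_μ`;
  `E_F_apply_of_casimir`: `E F v = ¼ (c - μ² + 2μ) v` if `C v = c v`.
* `E_F_apply_eq_zero_of_casimir_neg_one`: `C = -1`, `v ∈ V_1` ⟹ `E (F v) = 0`.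
* `eq_zero_of_F_eq_zero_of_casimir_neg_one`, `F_pow_apply_ne_zero_of_casimir_neg_one`: for
  `C = -1`, `F` is injective on `V_μ`, `μ ≠ 1` (`E F = -¼(μ - 1)²` there), so lowering a non-zero
  vector of odd weight `2n + 1` reaches weight `1` without vanishing;
  `exists_mem_wsp_one_ne_zero_of_odd`: with a weight-reversing injective `ε`, any non-zero
  vector of odd integral weight yields `V_1 ≠ 0`.
* `F_apply_eq_zero_of_weight_one` — **the weight-one annihilation lemma**: if `C = -1` on `V`,
  `ε` is an involution with `εH = -Hε`, `εE = Fε`, `εF = Eε`, `S` a multiplicative set of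
  operators commuting with `H, E, F, ε` (the finite-adelic / Hecke operators), and every
  subspace stable under `H, E, F, ε, S` and spanned by integral weight vectors is `⊥` or `⊤`,
  then `F v = 0` for all `v ∈ V_1`.  (Put `w = F v`; `E w = 0`; the span of the `s F^j w`,
  `s ε F^j w` is stable, hence everything if `w ≠ 0`; comparing weights, `v` lies in the span of
  the `s ε w`, whence `F v = ∑ s ε E w = 0`.)

Everything is proved; no definition and no named fact is introduced (D-0026).  Downstream use:
the archimedean half of Gelbart's dictionary in weight one (`IsOfWeightOne π` ⟹ a weight-one
vector killed by the lowering operator modulo `W'`), for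
`Literature.NumberTheory.Automorphic.exists_isNewform1_of_isPiOfArtinRep`.

## Mathlib / Literature search

`IsSl2Triple` and primitive vectors are Mathlib's; `wsp`, `casimir`, `casimir_apply_of_mem`,
`casimir_symm`, `apply_F_mem`, `apply_F_pow_mem`, `mem_wsp_neg_iff` are the tree's
(`Literature/Algebra/Lie/Sl2Strings`); `Module.End.eigenspaces_iSupIndep` (independence of
eigenspaces) is Mathlib's.  Mathlib has no `(𝔤, K)`-modules for `GL₂(ℝ)` and no limits of
discrete series (`lean search 'limit of discrete|LimitDiscrete|weightOne.*sl2'`: no hits).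
Nothing here duplicates an existing declaration.

## References

* D. Bump, *Automorphic Forms and Representations*, Cambridge Stud. Adv. Math. 55 (1997), §2.5:
  Thm. 2.5.2, Thm. 2.5.3 (proof: `L f_k = R f_{-k} = 0`), Thm. 2.5.4 (ii), Thm. 2.5.5 (iii)
  (limits of discrete series, `k = 1`). [Bump1997]
* S. Gelbart, *Three lectures on the modularity of `ρ̄_{E,3}` and the Langlands reciprocity
  conjecture*, in Cornell–Silverman–Stevens (1997): proof of Prop. 2.5 (chunk 229 of the held
  text: `X·φ_k = ((s₁ - s₂ + 1)/2 - k/2) φ_k`), Remark 2.5.2, Remark 2.5.5. [Gelbart1997]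
* J.-P. Serre, *Complex Semisimple Lie Algebras*, Ch. IV (the `sl₂` string calculus). [folklore]
-/

noncomputable section

namespace Literature.Algebra.Lie.Sl2

open Module LieModule

attribute [local instance 100] LieRing.ofAssociativeRing

variable {k : Type*} [Field k]
variable {V : Type*} [AddCommGroup V] [Module k V]
variable {H E F : Module.End k V}

/-! ### The Casimir operator read through `E F` -/

/-- `C v = 4 E F v + (μ² - 2μ) v` on `V_μ` (the Casimir of the symmetric triple `(-H, F, E)` is
the same operator, `casimir_symm`). [folklore] -/
lemma casimir_apply_of_mem_EF (t : IsSl2Triple H E F) {μ : k} {v : V} (hv : v ∈ wsp H μ) :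
    casimir H E F v = (4 : k) • E (F v) + (μ * μ - 2 * μ) • v := by
  have hv' : v ∈ wsp (-H) (-μ) := by rw [mem_wsp_neg_iff, neg_neg]; exact hv
  rw [← casimir_symm t, casimir_apply_of_mem hv']
  congr 1
  ring_nf

variable [CharZero k]

/-- If the Casimir operator acts on the weight vector `v ∈ V_μ` by `c`, then
`E F v = ¼ (c - μ² + 2μ) v`. [folklore] -/
lemma E_F_apply_of_casimir (t : IsSl2Triple H E F) {μ c : k} {v : V} (hv : v ∈ wsp H μ)
    (hc : casimir H E F v = c • v) :
    E (F v) = ((4 : k)⁻¹ * (c - (μ * μ - 2 * μ))) • v := by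
  have h := casimir_apply_of_mem_EF t hv
  rw [hc] at h
  have h4 : (4 : k) ≠ 0 := by norm_num
  have : (4 : k) • E (F v) = (c - (μ * μ - 2 * μ)) • v := by
    rw [sub_smul, h]; abel
  calc E (F v) = (4 : k)⁻¹ • ((4 : k) • E (F v)) := by rw [smul_smul, inv_mul_cancel₀ h4, one_smul]
    _ = _ := by rw [this, smul_smul]

/-- **Casimir `-1`, weight `1`: `E F v = 0`.** If `C` acts by `-1 = 1² - 2·1` on `v ∈ V_1` then
`E (F v) = 0` — in the `(𝔤𝔩₂, SO(2))`-module of the principal series `π(1, sgn)` of `GL₂(ℝ)`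
(Casimir `-1` in the normalisation `C = 4FE + H² + 2H`, `H` the weight operator of `SO(2)`), the
lowering of the weight-one vector is killed by the raising operator (Gelbart 1997, proof of
Prop. 2.5, chunk 229: "`X·φ_k = ((s₁ - s₂ + 1)/2 - k/2) φ_k` … if `X·φ₁` is to be `0`, we must have
`s₁ = s₂ = 0`"). [cite: Gelbart1997, proof of Prop. 2.5 (chunk 229)] -/
lemma E_F_apply_eq_zero_of_casimir_neg_one (t : IsSl2Triple H E F) {v : V} (hv : v ∈ wsp H 1)
    (hc : casimir H E F v = (-1 : k) • v) : E (F v) = 0 := by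
  rw [E_F_apply_of_casimir t hv hc]
  norm_num

/-- **Casimir `-1`: `F` is injective on weights `μ ≠ 1`.** If `C v = -v` for `v ∈ V_μ`, `μ ≠ 1`,
then `E F v = -¼ (μ - 1)² v ≠ 0` unless `v = 0`; in particular `F v = 0` forces `v = 0`. [folklore] -/
lemma eq_zero_of_F_eq_zero_of_casimir_neg_one (t : IsSl2Triple H E F) {μ : k} (hμ : μ ≠ 1) {v : V}
    (hv : v ∈ wsp H μ) (hc : casimir H E F v = (-1 : k) • v) (hF : F v = 0) : v = 0 := by
  have h := E_F_apply_of_casimir t hv hc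
  rw [hF, map_zero] at h
  have hcoef : (4 : k)⁻¹ * (-1 - (μ * μ - 2 * μ)) ≠ 0 := by
    refine mul_ne_zero (inv_ne_zero (by norm_num)) ?_
    have : -1 - (μ * μ - 2 * μ) = -((μ - 1) ^ 2) := by ring
    rw [this, neg_ne_zero]
    exact pow_ne_zero 2 (sub_ne_zero.2 hμ)
  exact (smul_eq_zero.1 h.symm).resolve_left hcoef

/-- **Casimir `-1`: lowering from an odd weight `2n + 1 ≥ 3` reaches weight one without
vanishing.** If `C` acts by `-1` on all of `V` and `v ∈ V_{2n+1}` is non-zero, then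
`F^j v ≠ 0` for `j ≤ n` (the weights `2n + 1 - 2i`, `i < n`, passed on the way are `≠ 1`).
[folklore] -/
lemma F_pow_apply_ne_zero_of_casimir_neg_one (t : IsSl2Triple H E F)
    (hC : ∀ w : V, casimir H E F w = (-1 : k) • w) {n : ℕ} {v : V} (hv : v ∈ wsp H ((2 * n + 1 : ℕ) : k))
    (hv0 : v ≠ 0) {j : ℕ} (hj : j ≤ n) : (F ^ j) v ≠ 0 := by
  induction j with
  | zero => simpa using hv0
  | succ j ih =>
    have hj' : j ≤ n := Nat.le_of_succ_le hj
    have hmem : (F ^ j) v ∈ wsp H (((2 * n + 1 : ℕ) : k) - 2 * j) := apply_F_pow_mem t hv j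
    have hne : ((2 * n + 1 : ℕ) : k) - 2 * j ≠ 1 := by
      intro h
      have : ((2 * n + 1 : ℕ) : k) - 2 * j - 1 = 0 := by rw [h, sub_self]
      have h2 : ((2 * (n - j) : ℕ) : k) = 0 := by
        rw [Nat.cast_mul, Nat.cast_sub hj']
        push_cast at this ⊢
        linear_combination this
      have : 2 * (n - j) = 0 := by exact_mod_cast h2
      omega
    intro hzero
    rw [pow_succ', Module.End.mul_apply] at hzero
    exact ih hj' (eq_zero_of_F_eq_zero_of_casimir_neg_one t hne hmem (hC _) hzero)

/-! ### Irreducible modules with a flip: the weight-one vector is killed by `F` -/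

/-- **The weight-one annihilation lemma.** Let `(H, E, F)` be an `sl₂`-triple on `V` whose
Casimir operator `C = 4FE + H² + 2H` acts by `-1`, let `ε` be an involution of `V` with
`ε H = -H ε`, `ε E = F ε`, `ε F = E ε` (a "flip", e.g. `diag(1, -1) ∈ O(2)` for
`(𝔤𝔩₂, O(2))`-modules, where `H` generates `SO(2)`), and let `S` be a multiplicatively closed set
of operators containing `1` and commuting with `H`, `E`, `F`, `ε` (e.g. the Hecke / finite-adelic
operators).  Suppose `V` is **irreducible** for `{H, E, F, ε} ∪ S`: every subspace stable under
all of them *and spanned by vectors of integral weight* is `⊥` or `⊤` (only such subspaces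
are tested, which is what the application to `(𝔤, K)`-modules can verify: there `SO(2)` acts on
integral weight vectors through characters).  Then **`F v = 0` for every vector `v` of weight `1`**.

Proof.  Put `w = F v ∈ V_{-1}`; `E w = 0` (`E_F_apply_eq_zero_of_casimir_neg_one`).  The span
`M` of the vectors `s F^j w` (weight `-1 - 2j`) and `s ε F^j w` (weight `1 + 2j`), `s ∈ S`,
`j ≥ 0`, is stable (`E F^{j+1} w ∈ k F^j w` by the Casimir, `E w = 0`, `ε² = 1`), hence `⊤` if
`w ≠ 0`; comparing weights (`H`-eigenspaces are independent), `v ∈ V_1` lies in the span of the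
`s ε w`, so `F v` lies in the span of the `s F ε w = s ε E w = 0`, i.e. `w = F v = 0` after all.
This is the algebraic heart of "`π_∞ = π(1, sgn)` forces `X·φ₁ = 0`" for the weight-one
vector `φ₁` of an irreducible `(𝔤𝔩₂, O(2)) × G(𝔸_f)`-module (Gelbart 1997, proof of Prop. 2.5,
chunk 229, and Remark 2.5.5; Bump 1997, proof of Thm. 2.5.3, chunk 205: "`L f_k = R f_{-k} = 0`",
and Thm. 2.5.4 (ii): for `λ = ¼`, `k = 1`, only the two modules with `K`-types `Σ^±(1)` exist).
[cite: Gelbart1997, proof of Prop. 2.5 (chunk 229) and Remark 2.5.5]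
[cite: Bump1997, Thm. 2.5.3 (proof) and Thm. 2.5.4 (ii)] -/
theorem F_apply_eq_zero_of_weight_one (t : IsSl2Triple H E F)
    (hC : ∀ w : V, casimir H E F w = (-1 : k) • w)
    (ε : Module.End k V) (hεε : ε * ε = 1) (hHε : H * ε = -(ε * H)) (hEε : E * ε = ε * F)
    (hFε : F * ε = ε * E)
    (S : Set (Module.End k V)) (hS1 : (1 : Module.End k V) ∈ S) (hSmul : ∀ s ∈ S, ∀ s' ∈ S, s * s' ∈ S)
    (hSH : ∀ s ∈ S, Commute s H) (hSE : ∀ s ∈ S, Commute s E) (hSF : ∀ s ∈ S, Commute s F)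
    (hSε : ∀ s ∈ S, Commute s ε)
    (hirr : ∀ U : Submodule k V,
      (∀ u ∈ U, H u ∈ U ∧ E u ∈ U ∧ F u ∈ U ∧ ε u ∈ U ∧ ∀ s ∈ S, s u ∈ U) →
      U ≤ Submodule.span k {u | u ∈ U ∧ ∃ m : ℤ, u ∈ wsp H (m : k)} → U = ⊥ ∨ U = ⊤)
    {v : V} (hv : v ∈ wsp H 1) : F v = 0 := by
  classical
  set w := F v with hw
  by_contra hw0
  -- weights of the string below `w`
  have hwμ : w ∈ wsp H (-1 : k) := by
    have h := apply_F_mem t hv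
    rwa [show (1 : k) - 2 = -1 by norm_num] at h
  have hEw : E w = 0 := E_F_apply_eq_zero_of_casimir_neg_one t hv (hC v)
  have hFj : ∀ j : ℕ, (F ^ j) w ∈ wsp H (-1 - 2 * (j : k)) := fun j => apply_F_pow_mem t hwμ j
  -- `E F^{j+1} w ∈ k ∙ F^j w` and `E w = 0`
  have hEF : ∀ j : ℕ, ∃ a : k, E ((F ^ (j + 1)) w) = a • (F ^ j) w := fun j => by
    refine ⟨(4 : k)⁻¹ * (-1 - ((-1 - 2 * (j : k)) * (-1 - 2 * (j : k)) - 2 * (-1 - 2 * (j : k)))), ?_⟩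
    rw [pow_succ', Module.End.mul_apply]
    exact E_F_apply_of_casimir t (hFj j) (hC _)
  -- `ε` on weight spaces
  have hεwsp : ∀ {μ : k} {u : V}, u ∈ wsp H μ → ε u ∈ wsp H (-μ) := fun {μ u} hu => by
    rw [mem_wsp_iff] at hu ⊢
    have := LinearMap.congr_fun hHε u
    simp only [Module.End.mul_apply, LinearMap.neg_apply, hu, map_smul] at this
    rw [this, neg_smul]
  -- the candidate submodule
  let gen : Set V := {x | ∃ s ∈ S, ∃ j : ℕ, x = s ((F ^ j) w) ∨ x = s (ε ((F ^ j) w))}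
  let M : Submodule k V := Submodule.span k gen
  have hgen_mem : ∀ s ∈ S, ∀ j : ℕ, s ((F ^ j) w) ∈ M ∧ s (ε ((F ^ j) w)) ∈ M := fun s hs j =>
    ⟨Submodule.subset_span ⟨s, hs, j, Or.inl rfl⟩, Submodule.subset_span ⟨s, hs, j, Or.inr rfl⟩⟩
  -- stability of `M`: it suffices to check the generators
  have hstab : ∀ (T : Module.End k V), (∀ x ∈ gen, T x ∈ M) → ∀ u ∈ M, T u ∈ M := by
    intro T hT u hu
    induction hu using Submodule.span_induction with
    | mem x hx => exact hT x hx
    | zero => rw [map_zero]; exact zero_mem _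
    | add x y _ _ hx hy => rw [map_add]; exact add_mem hx hy
    | smul a x _ hx => rw [map_smul]; exact Submodule.smul_mem _ a hx
  have hM : ∀ u ∈ M, H u ∈ M ∧ E u ∈ M ∧ F u ∈ M ∧ ε u ∈ M ∧ ∀ s ∈ S, s u ∈ M := by
    intro u hu
    refine ⟨hstab H ?_ u hu, hstab E ?_ u hu, hstab F ?_ u hu, hstab ε ?_ u hu,
      fun s hs => hstab s ?_ u hu⟩
    · -- `H`: weight vectors
      rintro x ⟨s, hs, j, rfl | rfl⟩
      · have hx : s ((F ^ j) w) ∈ wsp H (-1 - 2 * (j : k)) := by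
          rw [mem_wsp_iff, ← Module.End.mul_apply, ← (hSH s hs).eq, Module.End.mul_apply,
            mem_wsp_iff.mp (hFj j), map_smul]
        rw [mem_wsp_iff.mp hx]
        exact Submodule.smul_mem _ _ (hgen_mem s hs j).1
      · have hx : s (ε ((F ^ j) w)) ∈ wsp H (-(-1 - 2 * (j : k))) := by
          rw [mem_wsp_iff, ← Module.End.mul_apply, ← (hSH s hs).eq, Module.End.mul_apply,
            mem_wsp_iff.mp (hεwsp (hFj j)), map_smul]
        rw [mem_wsp_iff.mp hx]
        exact Submodule.smul_mem _ _ (hgen_mem s hs j).2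
    · -- `E`
      rintro x ⟨s, hs, j, rfl | rfl⟩
      · rw [← Module.End.mul_apply, ← (hSE s hs).eq, Module.End.mul_apply]
        cases j with
        | zero => rw [pow_zero, Module.End.one_apply, hEw, map_zero]; exact zero_mem _
        | succ j =>
          obtain ⟨a, ha⟩ := hEF j
          rw [ha, map_smul]
          exact Submodule.smul_mem _ _ (hgen_mem s hs j).1
      · rw [← Module.End.mul_apply, ← (hSE s hs).eq, Module.End.mul_apply, ← Module.End.mul_apply E ε,
          hEε, Module.End.mul_apply, ← Module.End.mul_apply F, ← pow_succ']
        exact (hgen_mem s hs (j + 1)).2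
    · -- `F`
      rintro x ⟨s, hs, j, rfl | rfl⟩
      · rw [← Module.End.mul_apply, ← (hSF s hs).eq, Module.End.mul_apply, ← Module.End.mul_apply F,
          ← pow_succ']
        exact (hgen_mem s hs (j + 1)).1
      · rw [← Module.End.mul_apply, ← (hSF s hs).eq, Module.End.mul_apply, ← Module.End.mul_apply F ε,
          hFε, Module.End.mul_apply]
        cases j with
        | zero => rw [pow_zero, Module.End.one_apply, hEw, map_zero, map_zero]; exact zero_mem _
        | succ j =>
          obtain ⟨a, ha⟩ := hEF j
          rw [ha, map_smul, map_smul]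
          exact Submodule.smul_mem _ _ (hgen_mem s hs j).2
    · -- `ε`
      rintro x ⟨s, hs, j, rfl | rfl⟩
      · rw [← Module.End.mul_apply, ← (hSε s hs).eq, Module.End.mul_apply]
        exact (hgen_mem s hs j).2
      · rw [← Module.End.mul_apply, ← (hSε s hs).eq, Module.End.mul_apply, ← Module.End.mul_apply ε ε,
          hεε, Module.End.one_apply]
        exact (hgen_mem s hs j).1
    · -- `s ∈ S`
      rintro x ⟨s', hs', j, rfl | rfl⟩
      · rw [← Module.End.mul_apply]
        exact (hgen_mem _ (hSmul s hs s' hs') j).1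
      · rw [← Module.End.mul_apply]
        exact (hgen_mem _ (hSmul s hs s' hs') j).2
  -- `M ≠ ⊥` (it contains `w = 1 (F^0 w)`), so `M = ⊤`
  have hwM : w ∈ M := by
    have := (hgen_mem 1 hS1 0).1
    rwa [pow_zero, Module.End.one_apply, Module.End.one_apply] at this
  have hMspan : M ≤ Submodule.span k {u | u ∈ M ∧ ∃ m : ℤ, u ∈ wsp H (m : k)} := by
    refine Submodule.span_le.2 ?_
    rintro x ⟨s, hs, j, rfl | rfl⟩
    · refine Submodule.subset_span ⟨(hgen_mem s hs j).1, -1 - 2 * (j : ℤ), ?_⟩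
      have hx : s ((F ^ j) w) ∈ wsp H (-1 - 2 * (j : k)) := by
        rw [mem_wsp_iff, ← Module.End.mul_apply, ← (hSH s hs).eq, Module.End.mul_apply,
          mem_wsp_iff.mp (hFj j), map_smul]
      convert hx using 2
      push_cast; ring
    · refine Submodule.subset_span ⟨(hgen_mem s hs j).2, 1 + 2 * (j : ℤ), ?_⟩
      have hx : s (ε ((F ^ j) w)) ∈ wsp H (-(-1 - 2 * (j : k))) := by
        rw [mem_wsp_iff, ← Module.End.mul_apply, ← (hSH s hs).eq, Module.End.mul_apply,
          mem_wsp_iff.mp (hεwsp (hFj j)), map_smul]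
      convert hx using 2
      push_cast; ring
  have hMtop : M = ⊤ := by
    rcases hirr M hM hMspan with h | h
    · exact absurd (h ▸ hwM : w ∈ (⊥ : Submodule k V)) (by rwa [Submodule.mem_bot])
    · exact h
  -- split the generators by weight: the weight-one ones are the `s (ε w)`
  let M₁ : Submodule k V := Submodule.span k {x | ∃ s ∈ S, x = s (ε w)}
  let Mne : Submodule k V := ⨆ μ : {μ : k // μ ≠ 1}, wsp H μ.1
  have hM₁ : M₁ ≤ wsp H 1 := by
    refine Submodule.span_le.2 ?_
    rintro x ⟨s, hs, rfl⟩
    change s (ε w) ∈ wsp H 1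
    rw [mem_wsp_iff, ← Module.End.mul_apply, ← (hSH s hs).eq, Module.End.mul_apply]
    have : ε w ∈ wsp H 1 := by have := hεwsp hwμ; rwa [neg_neg] at this
    rw [mem_wsp_iff.mp this, map_smul]
  have hgen_split : gen ⊆ (M₁ ⊔ Mne : Submodule k V) := by
    rintro x ⟨s, hs, j, rfl | rfl⟩
    · -- weight `-1 - 2j ≠ 1`
      refine Submodule.mem_sup_right ?_
      have hx : s ((F ^ j) w) ∈ wsp H (-1 - 2 * (j : k)) := by
        rw [mem_wsp_iff, ← Module.End.mul_apply, ← (hSH s hs).eq, Module.End.mul_apply,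
          mem_wsp_iff.mp (hFj j), map_smul]
      have hne : (-1 - 2 * (j : k)) ≠ 1 := by
        intro h
        have : (2 : k) * ((j : k) + 1) = 0 := by linear_combination -h
        have h2 : ((j : k) + 1) = 0 := by simpa using this
        have : ((j + 1 : ℕ) : k) = 0 := by push_cast; exact h2
        exact Nat.succ_ne_zero j (by exact_mod_cast this)
      exact Submodule.mem_iSup_of_mem ⟨_, hne⟩ hx
    · cases j with
      | zero =>
        refine Submodule.mem_sup_left (Submodule.subset_span ⟨s, hs, ?_⟩)
        rw [pow_zero, Module.End.one_apply]
      | succ j =>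
        refine Submodule.mem_sup_right ?_
        have hx : s (ε ((F ^ (j + 1)) w)) ∈ wsp H (-(-1 - 2 * ((j + 1 : ℕ) : k))) := by
          rw [mem_wsp_iff, ← Module.End.mul_apply, ← (hSH s hs).eq, Module.End.mul_apply,
            mem_wsp_iff.mp (hεwsp (hFj (j + 1))), map_smul]
        have hne : (-(-1 - 2 * ((j + 1 : ℕ) : k))) ≠ 1 := by
          intro h
          have h2 : (2 : k) * ((j : k) + 1) = 0 := by push_cast at h; linear_combination h
          have h3 : ((j : k) + 1) = 0 := by simpa using h2
          have : ((j + 1 : ℕ) : k) = 0 := by push_cast; exact h3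
          exact Nat.succ_ne_zero j (by exact_mod_cast this)
        exact Submodule.mem_iSup_of_mem ⟨_, hne⟩ hx
  have hMle : M ≤ M₁ ⊔ Mne := Submodule.span_le.2 hgen_split
  -- `v ∈ M = ⊤`, and `v` has weight one: `v ∈ M₁`
  have hvM : v ∈ M₁ ⊔ Mne := hMle (hMtop ▸ Submodule.mem_top)
  obtain ⟨m₁, hm₁, m', hm', hvm⟩ := Submodule.mem_sup.1 hvM
  have hdisj : Disjoint (wsp H (1 : k)) Mne := by
    have hind := Module.End.eigenspaces_iSupIndep H
    have h := hind (1 : k)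
    -- `⨆ μ ≠ 1, wsp H μ = Mne`
    refine h.mono_right ?_
    refine iSup_le fun μ => ?_
    exact le_iSup₂_of_le (f := fun (j : k) (_ : j ≠ 1) => H.eigenspace j) μ.1 μ.2 le_rfl
  have hm'0 : m' = 0 := by
    have hm'1 : m' ∈ wsp H (1 : k) := by
      have : m' = v - m₁ := by rw [← hvm]; abel
      rw [this]
      exact sub_mem hv (hM₁ hm₁)
    exact (Submodule.disjoint_def.1 hdisj) m' hm'1 hm'
  rw [hm'0, add_zero] at hvm
  -- hence `F v ∈ span {s (F (ε w))} = 0`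
  have hFM₁ : ∀ x ∈ M₁, F x = 0 := by
    have hg : ∀ x ∈ ({x | ∃ s ∈ S, x = s (ε w)} : Set V), F x = 0 := by
      rintro x ⟨s, hs, rfl⟩
      rw [← Module.End.mul_apply, ← (hSF s hs).eq, Module.End.mul_apply, ← Module.End.mul_apply F ε,
        hFε, Module.End.mul_apply, hEw, map_zero, map_zero]
    intro x hx
    induction hx using Submodule.span_induction with
    | mem x hx => exact hg x hx
    | zero => exact map_zero F
    | add x y _ _ hx hy => rw [map_add, hx, hy, add_zero]
    | smul a x _ hx => rw [map_smul, hx, smul_zero]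
  have hFv : F v = 0 := by
    rw [← hvm]
    exact hFM₁ m₁ hm₁
  exact hw0 (hw ▸ hFv)


/-- **From any odd weight to weight one.** If `C` acts by `-1` on `V`, `ε` is an injective
operator anticommuting with `H` (so `ε V_μ ⊆ V_{-μ}`), and `v ≠ 0` has odd integral weight `m`,
then `V_1 ≠ 0`: for `m = 2n + 1 ≥ 1` take `F^n v`, for `m ≤ -1` take `F^n (ε v)` with
`-m = 2n + 1` (`F_pow_apply_ne_zero_of_casimir_neg_one`).  In the `(𝔤𝔩₂, O(2))`-module of
`π(1, sgn)` all weights are odd (`-1 ∈ SO(2)` acts by `-1`) and this produces the weight-one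
vector (Gelbart 1997, proof of Prop. 2.5, chunk 229: "`π(1, sgn)` consists only of "odd"
functions"). [cite: Gelbart1997, proof of Prop. 2.5 (chunk 229)] -/
theorem exists_mem_wsp_one_ne_zero_of_odd (t : IsSl2Triple H E F)
    (hC : ∀ w : V, casimir H E F w = (-1 : k) • w)
    (ε : Module.End k V) (hHε : H * ε = -(ε * H)) (hε : Function.Injective ε)
    {m : ℤ} (hm : Odd m) {v : V} (hv : v ∈ wsp H (m : k)) (hv0 : v ≠ 0) :
    ∃ u ∈ wsp H (1 : k), u ≠ 0 := by
  -- reduce to a positive odd weight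
  have key : ∀ {n : ℕ} {x : V}, x ∈ wsp H ((2 * n + 1 : ℕ) : k) → x ≠ 0 → ∃ u ∈ wsp H (1 : k), u ≠ 0 := by
    intro n x hx hx0
    refine ⟨(F ^ n) x, ?_, F_pow_apply_ne_zero_of_casimir_neg_one t hC hx hx0 le_rfl⟩
    have h := apply_F_pow_mem t hx n
    convert h using 2
    push_cast; ring
  obtain ⟨r, hr⟩ := hm
  rcases le_or_gt 0 r with hr0 | hr0
  · -- `m = 2r + 1 ≥ 1`
    lift r to ℕ using hr0
    refine key (n := r) ?_ hv0
    convert hv using 2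
    rw [hr]; push_cast; ring
  · -- `m ≤ -1`: flip with `ε`
    have hεv : ε v ∈ wsp H (-(m : k)) := by
      rw [mem_wsp_iff] at hv ⊢
      have := LinearMap.congr_fun hHε v
      simp only [Module.End.mul_apply, LinearMap.neg_apply, hv, map_smul] at this
      rw [this, neg_smul]
    have hεv0 : ε v ≠ 0 := fun h => hv0 (hε (by rw [h, map_zero]))
    obtain ⟨n, hn⟩ : ∃ n : ℕ, (-(m : k)) = ((2 * n + 1 : ℕ) : k) := by
      refine ⟨(-r - 1).toNat, ?_⟩
      have h1 : ((-r - 1).toNat : ℤ) = -r - 1 := Int.toNat_of_nonneg (by omega)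
      have h2 : (-(m : k)) = (((2 * ((-r - 1).toNat : ℤ) + 1 : ℤ)) : k) := by
        rw [h1, hr]; push_cast; ring
      rw [h2]; push_cast; ring
    rw [hn] at hεv
    exact key hεv hεv0

end Literature.Algebra.Lie.Sl2

end
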